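import Mathlib
import Summits.ValiantsHypothesis.ValiantsHypothesis.Theorems.RigidityForcesSymmetryRankRigidMinimalReprLaplaceDefs
import Summits.ValiantsHypothesis.ValiantsHypothesis.Theorems.RigidityForcesSymmetryRankRigidMinimalReprLaplaceFourOptimal

/-!
# Laplace optimality is hereditary under slot restriction; the factor-two bound at the next order
# (crux `RankRigidMinimalRepr`, stmt-ValiantsHypothesis-18034; frontier rung `LaplaceOptimalFive`, stmt-24813)

The RESTRICTION of a split-rank-one decomposition of the permutation pattern `P_{d+1}(v) = [v injective]` to the
assignments with `v i = a` (slot `i` pinned to the value `a`, the remaining slots relabelled by `Fin.succAbove i` and the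
remaining values by `Fin.succAbove a`, i.e. `v = i.insertNth a (a.succAbove ∘ v')`) is a split-rank-one decomposition of
`P_d`, in the data format of `LaplaceOptimal`: a term across the split `S` becomes a term across the restricted split
`{k : i.succAbove k ∈ S}`, so its Laplace weight `|S|!(d+1-|S|)!` becomes `(|S|-1)!(d+1-|S|)!` if `i ∈ S` and `|S|!(d-|S|)!`
if `i ∉ S`.

* `restrict` — `LaplaceOptimal d` bounds every restriction of a decomposition of `P_{d+1}`;
* `weight_ge_half` — averaging `restrict` over the `d+1` slots: `LaplaceOptimal d` implies HALF of `LaplaceOptimal (d+1)`,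
  `(d+1)! ≤ 2 · Σ_t |S_t|!(d+1-|S_t|)!` (over the `d+1` restrictions each term is counted with total weight exactly twice
  its own; the averaging is tight on Laplace AND on value-Laplace expansions, so the factor `2` is the honest content of
  restriction alone);
* `laplace_five_weight_ge_sixty` — with the landed `laplaceOptimal_four`: every split-rank-one decomposition of the
  `5 × 5` permutation pattern has Laplace weight `≥ 60` (the item `LaplaceOptimalFive`, stmt-24813, asks for `≥ 120`).

No new definitions (the embedding and the restricted split are written out).  HONEST FRAMING: a PARTIAL result toward
the frontier rung `LaplaceOptimalFive` (weight `≥ 60` of the conjectured `120`) and reusable restriction infrastructure;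
`LaplaceOptimal 5` itself stays OPEN here, the crux `RankRigidMinimalRepr` stays OPEN, and nothing in this file bears
on `VP ≠ VNP`.
-/

set_option autoImplicit false

-- the mandated summit-side namespace repeats a component by design (single-problem summit)
set_option linter.dupNamespace false

namespace Summit.ValiantsHypothesis.ValiantsHypothesis.Theorems.RigidityForcesSymmetryRankRigidMinimalRepr

namespace LaplaceRestrict

open Finset

variable {d : ℕ}

/-! ### §1 The slot/value embedding `v' ↦ i.insertNth a (a.succAbove ∘ v')` -/

/-- Value at the pinned slot. -/
theorem ext_apply_same (i a : Fin (d + 1)) (v : Fin d → Fin d) :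
    (i.insertNth a (fun k => a.succAbove (v k)) : Fin (d + 1) → Fin (d + 1)) i = a := by
  simp

/-- Values at the other slots. -/
theorem ext_apply_succAbove (i a : Fin (d + 1)) (v : Fin d → Fin d) (k : Fin d) :
    (i.insertNth a (fun k => a.succAbove (v k)) : Fin (d + 1) → Fin (d + 1)) (i.succAbove k) =
      a.succAbove (v k) := by
  simp

/-- The embedded assignment is injective iff the small one is. -/
theorem ext_injective_iff (i a : Fin (d + 1)) (v : Fin d → Fin d) :
    Function.Injective (i.insertNth a (fun k => a.succAbove (v k)) : Fin (d + 1) → Fin (d + 1)) ↔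
      Function.Injective v := by
  set e : Fin (d + 1) → Fin (d + 1) := i.insertNth a (fun k => a.succAbove (v k)) with he
  constructor
  · intro h k k' hkk'
    have h1 : e (i.succAbove k) = e (i.succAbove k') := by
      rw [he, ext_apply_succAbove, ext_apply_succAbove, hkk']
    exact Fin.succAbove_right_injective (h h1)
  · intro h j j' hjj'
    rw [he] at hjj'
    rcases Fin.eq_self_or_eq_succAbove i j with rfl | ⟨k, rfl⟩
    · rcases Fin.eq_self_or_eq_succAbove j j' with h' | ⟨k', rfl⟩
      · exact h'.symm
      · rw [ext_apply_same, ext_apply_succAbove] at hjj'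
        exact absurd hjj'.symm (Fin.succAbove_ne a (v k'))
    · rcases Fin.eq_self_or_eq_succAbove i j' with rfl | ⟨k', rfl⟩
      · rw [ext_apply_same, ext_apply_succAbove] at hjj'
        exact absurd hjj' (Fin.succAbove_ne a (v k))
      · rw [ext_apply_succAbove, ext_apply_succAbove] at hjj'
        rw [h (Fin.succAbove_right_injective hjj')]

/-! ### §2 The restricted split `{k : i.succAbove k ∈ S}` and its cardinality -/

/-- `S ∖ {i}` is the image of the restricted split under `i.succAbove`. -/
theorem erase_eq_map (i : Fin (d + 1)) (S : Finset (Fin (d + 1))) :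
    S.erase i = (univ.filter (fun k : Fin d => i.succAbove k ∈ S)).map (Fin.succAboveEmb i) := by
  ext j
  simp only [mem_erase, mem_map, Fin.succAboveEmb_apply, mem_filter, mem_univ, true_and]
  constructor
  · rintro ⟨hji, hjS⟩
    rcases Fin.eq_self_or_eq_succAbove i j with rfl | ⟨k, rfl⟩
    · exact absurd rfl hji
    · exact ⟨k, hjS, rfl⟩
  · rintro ⟨k, hk, rfl⟩
    exact ⟨Fin.succAbove_ne i k, hk⟩

/-- Cardinality: `|S| = |{k : i.succAbove k ∈ S}| + [i ∈ S]`. -/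
theorem card_eq (i : Fin (d + 1)) (S : Finset (Fin (d + 1))) :
    S.card = (univ.filter (fun k : Fin d => i.succAbove k ∈ S)).card + (if i ∈ S then 1 else 0) := by
  have h1 : (S.erase i).card = (univ.filter (fun k : Fin d => i.succAbove k ∈ S)).card := by
    rw [erase_eq_map, card_map]
  by_cases hi : i ∈ S
  · rw [if_pos hi, ← h1]
    exact (card_erase_add_one hi).symm
  · rw [if_neg hi, add_zero, ← h1, erase_eq_of_notMem hi]

/-! ### §3 Restriction of a decomposition -/

/-- **Laplace optimality is hereditary under restriction.**  If `LaplaceOptimal d` holds, then for every split-rank-one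
decomposition of `P_{d+1}` and every slot `i` (pinned to any value `a`):
`d! ≤ Σ_t c_t! · (d - c_t)!` with `c_t = |{k : i.succAbove k ∈ S_t}|`. -/
theorem restrict (hL : LaplaceOptimal d) {N : ℕ} (T : Finset (Fin N)) (S : Fin N → Finset (Fin (d + 1)))
    (u w : Fin N → (Fin (d + 1) → Fin (d + 1)) → ℂ)
    (hu : ∀ t, ∀ v v' : Fin (d + 1) → Fin (d + 1), (∀ j ∈ S t, v j = v' j) → u t v = u t v')
    (hw : ∀ t, ∀ v v' : Fin (d + 1) → Fin (d + 1), (∀ j, j ∉ S t → v j = v' j) → w t v = w t v')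
    (hsum : ∀ v : Fin (d + 1) → Fin (d + 1), (∑ t ∈ T, u t v * w t v) = if Function.Injective v then 1 else 0)
    (i a : Fin (d + 1)) :
    d.factorial ≤ ∑ t ∈ T, (univ.filter (fun k : Fin d => i.succAbove k ∈ S t)).card.factorial *
      (d - (univ.filter (fun k : Fin d => i.succAbove k ∈ S t)).card).factorial := by
  refine hL N T (fun t => univ.filter (fun k : Fin d => i.succAbove k ∈ S t))
    (fun t v => u t (i.insertNth a (fun k => a.succAbove (v k))))
    (fun t v => w t (i.insertNth a (fun k => a.succAbove (v k)))) ?_ ?_ ?_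
  · intro t v v' hvv'
    refine hu t _ _ (fun j hj => ?_)
    rcases Fin.eq_self_or_eq_succAbove i j with rfl | ⟨k, rfl⟩
    · rw [ext_apply_same, ext_apply_same]
    · have hk : k ∈ univ.filter (fun k : Fin d => i.succAbove k ∈ S t) := by simpa using hj
      rw [ext_apply_succAbove, ext_apply_succAbove, hvv' k hk]
  · intro t v v' hvv'
    refine hw t _ _ (fun j hj => ?_)
    rcases Fin.eq_self_or_eq_succAbove i j with rfl | ⟨k, rfl⟩
    · rw [ext_apply_same, ext_apply_same]
    · have hk : k ∉ univ.filter (fun k : Fin d => i.succAbove k ∈ S t) := by simpa using hj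
      rw [ext_apply_succAbove, ext_apply_succAbove, hvv' k hk]
  · intro v
    simp only [hsum, ext_injective_iff]

/-! ### §4 Averaging over the slots: the factor-two bound -/

/-- The weight bookkeeping of one term under the `d+1` restrictions: with `c = |S|`,
`c · (c-1)!(d-(c-1))! + (d+1-c) · c!(d-c)! ≤ 2 · c!(d+1-c)!` (equality for `1 ≤ c ≤ d`). -/
theorem term_bound (d c : ℕ) (hc : c ≤ d + 1) :
    c * ((c - 1).factorial * (d - (c - 1)).factorial) + (d + 1 - c) * (c.factorial * (d - c).factorial) ≤
      2 * (c.factorial * (d + 1 - c).factorial) := by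
  rcases Nat.eq_zero_or_pos c with rfl | hc0
  · -- `c = 0`: a full term in every restriction
    have e1 : (0 : ℕ) * ((0 - 1).factorial * (d - (0 - 1)).factorial) = 0 := zero_mul _
    rw [e1, zero_add, Nat.sub_zero, Nat.sub_zero, Nat.factorial_zero, one_mul, one_mul, ← Nat.factorial_succ]
    exact Nat.le_mul_of_pos_left _ (by norm_num)
  · rcases Nat.lt_or_ge d c with hcd | hcd
    · -- `c = d + 1`
      have hc' : c = d + 1 := by omega
      subst hc'
      rw [show d + 1 - 1 = d from rfl, Nat.sub_self, Nat.sub_self, show d - (d + 1) = 0 by omega, zero_mul,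
        add_zero, Nat.factorial_zero, mul_one, mul_one, ← Nat.factorial_succ]
      exact Nat.le_mul_of_pos_left _ (by norm_num)
    · -- `1 ≤ c ≤ d`
      have h1 : c * (c - 1).factorial = c.factorial := Nat.mul_factorial_pred (by omega)
      have h2 : (d + 1 - c) * (d - c).factorial = (d + 1 - c).factorial := by
        have := Nat.mul_factorial_pred (n := d + 1 - c) (by omega)
        rwa [show d + 1 - c - 1 = d - c by omega] at this
      have h3 : d - (c - 1) = d + 1 - c := by omega
      calc c * ((c - 1).factorial * (d - (c - 1)).factorial) + (d + 1 - c) * (c.factorial * (d - c).factorial)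
          = (c * (c - 1).factorial) * (d + 1 - c).factorial +
              c.factorial * ((d + 1 - c) * (d - c).factorial) := by
            rw [h3]; ring
        _ = 2 * (c.factorial * (d + 1 - c).factorial) := by rw [h1, h2]; ring
        _ ≤ 2 * (c.factorial * (d + 1 - c).factorial) := le_rfl

/-- The restricted weight of the term `S` at slot `i`, in closed form. -/
theorem res_weight_eq (i : Fin (d + 1)) (S : Finset (Fin (d + 1))) :
    (univ.filter (fun k : Fin d => i.succAbove k ∈ S)).card.factorial *
        (d - (univ.filter (fun k : Fin d => i.succAbove k ∈ S)).card).factorial =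
      if i ∈ S then (S.card - 1).factorial * (d - (S.card - 1)).factorial
      else S.card.factorial * (d - S.card).factorial := by
  have h := card_eq i S
  by_cases hi : i ∈ S
  · rw [if_pos hi] at h
    rw [if_pos hi, show (univ.filter (fun k : Fin d => i.succAbove k ∈ S)).card = S.card - 1 by omega]
  · rw [if_neg hi, add_zero] at h
    rw [if_neg hi, ← h]

/-- Sum over the slots of the restricted weights of one term: at most twice its own weight. -/
theorem sum_res_weight_le (S : Finset (Fin (d + 1))) :
    (∑ i : Fin (d + 1), (univ.filter (fun k : Fin d => i.succAbove k ∈ S)).card.factorial *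
        (d - (univ.filter (fun k : Fin d => i.succAbove k ∈ S)).card).factorial) ≤
      2 * (S.card.factorial * (d + 1 - S.card).factorial) := by
  simp_rw [res_weight_eq]
  rw [sum_ite, sum_const, sum_const, smul_eq_mul, smul_eq_mul]
  have hS : (univ.filter (fun i : Fin (d + 1) => i ∈ S)) = S := by ext; simp
  have hSc : (univ.filter (fun i : Fin (d + 1) => ¬ i ∈ S)).card = d + 1 - S.card := by
    have : (univ.filter (fun i : Fin (d + 1) => ¬ i ∈ S)) = Sᶜ := by ext; simp
    rw [this, card_compl, Fintype.card_fin]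
  rw [hS, hSc]
  exact term_bound d S.card (by simpa using S.card_le_univ)

/-- **`LaplaceOptimal d` gives half of `LaplaceOptimal (d+1)`.**  For every split-rank-one decomposition of the
permutation pattern of order `d+1`: `(d+1)! ≤ 2 · Σ_t |S_t|!(d+1-|S_t|)!`. -/
theorem weight_ge_half (hL : LaplaceOptimal d) {N : ℕ} (T : Finset (Fin N)) (S : Fin N → Finset (Fin (d + 1)))
    (u w : Fin N → (Fin (d + 1) → Fin (d + 1)) → ℂ)
    (hu : ∀ t, ∀ v v' : Fin (d + 1) → Fin (d + 1), (∀ j ∈ S t, v j = v' j) → u t v = u t v')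
    (hw : ∀ t, ∀ v v' : Fin (d + 1) → Fin (d + 1), (∀ j, j ∉ S t → v j = v' j) → w t v = w t v')
    (hsum : ∀ v : Fin (d + 1) → Fin (d + 1), (∑ t ∈ T, u t v * w t v) = if Function.Injective v then 1 else 0) :
    (d + 1).factorial ≤ 2 * ∑ t ∈ T, (S t).card.factorial * (d + 1 - (S t).card).factorial := by
  have h := fun i : Fin (d + 1) => restrict hL T S u w hu hw hsum i i
  calc (d + 1).factorial = ∑ _i : Fin (d + 1), d.factorial := by
          rw [sum_const, card_univ, Fintype.card_fin, smul_eq_mul, Nat.factorial_succ]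
    _ ≤ ∑ i : Fin (d + 1), ∑ t ∈ T, (univ.filter (fun k : Fin d => i.succAbove k ∈ S t)).card.factorial *
          (d - (univ.filter (fun k : Fin d => i.succAbove k ∈ S t)).card).factorial :=
          sum_le_sum (fun i _ => h i)
    _ = ∑ t ∈ T, ∑ i : Fin (d + 1), (univ.filter (fun k : Fin d => i.succAbove k ∈ S t)).card.factorial *
          (d - (univ.filter (fun k : Fin d => i.succAbove k ∈ S t)).card).factorial :=
          sum_comm
    _ ≤ ∑ t ∈ T, 2 * ((S t).card.factorial * (d + 1 - (S t).card).factorial) :=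
          sum_le_sum (fun t _ => sum_res_weight_le (S t))
    _ = 2 * ∑ t ∈ T, (S t).card.factorial * (d + 1 - (S t).card).factorial := by rw [mul_sum]

end LaplaceRestrict

/-! ### §5 Order five -/

/-- **Half of `LaplaceOptimalFive` (stmt-24813).**  Every split-rank-one decomposition
`P₅(v) = Σ_t u_t(v|_{S_t}) w_t(v|_{S_tᶜ})` of the `5 × 5` permutation pattern has Laplace weight
`Σ_t |S_t|!(5-|S_t|)! ≥ 60` — from the landed `laplaceOptimal_four` by restriction and averaging.  (The item asks for
`≥ 120`; this is the honest content of the restriction method alone.) -/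
theorem laplace_five_weight_ge_sixty (N : ℕ) (T : Finset (Fin N)) (S : Fin N → Finset (Fin 5))
    (u w : Fin N → (Fin 5 → Fin 5) → ℂ)
    (hu : ∀ t, ∀ v v' : Fin 5 → Fin 5, (∀ i ∈ S t, v i = v' i) → u t v = u t v')
    (hw : ∀ t, ∀ v v' : Fin 5 → Fin 5, (∀ i, i ∉ S t → v i = v' i) → w t v = w t v')
    (hsum : ∀ v : Fin 5 → Fin 5, (∑ t ∈ T, u t v * w t v) = if Function.Injective v then 1 else 0) :
    60 ≤ ∑ t ∈ T, (S t).card.factorial * (5 - (S t).card).factorial := by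
  have h := LaplaceRestrict.weight_ge_half (d := 4) laplaceOptimal_four T S u w hu hw hsum
  change Nat.factorial 5 ≤ 2 * ∑ t ∈ T, (S t).card.factorial * (5 - (S t).card).factorial at h
  have h5 : Nat.factorial 5 = 120 := by decide
  omega

/-- **Heredity, general order.**  `LaplaceOptimal d` gives half of `LaplaceOptimal (d+1)` at every order (so a proof of
`LaplaceOptimal 5` would at once give weight `≥ 360` for the `6 × 6` pattern, etc.). -/
theorem laplace_weight_ge_half_succ (d : ℕ) (hL : LaplaceOptimal d) (N : ℕ) (T : Finset (Fin N))
    (S : Fin N → Finset (Fin (d + 1))) (u w : Fin N → (Fin (d + 1) → Fin (d + 1)) → ℂ)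
    (hu : ∀ t, ∀ v v' : Fin (d + 1) → Fin (d + 1), (∀ j ∈ S t, v j = v' j) → u t v = u t v')
    (hw : ∀ t, ∀ v v' : Fin (d + 1) → Fin (d + 1), (∀ j, j ∉ S t → v j = v' j) → w t v = w t v')
    (hsum : ∀ v : Fin (d + 1) → Fin (d + 1), (∑ t ∈ T, u t v * w t v) = if Function.Injective v then 1 else 0) :
    (d + 1).factorial ≤ 2 * ∑ t ∈ T, (S t).card.factorial * (d + 1 - (S t).card).factorial :=
  LaplaceRestrict.weight_ge_half hL T S u w hu hw hsum

end Summit.ValiantsHypothesis.ValiantsHypothesis.Theorems.RigidityForcesSymmetryRankRigidMinimalRepr
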